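import Mathlib.Probability.Independence.Integration
import Mathlib.Probability.Moments.Variance
import Literature.MathematicalPhysics.KineticTheory.InfiniteChainGibbsMomenta
import Literature.MathematicalPhysics.KineticTheory.InfiniteChainSpecificationLocality
import Literature.MathematicalPhysics.KineticTheory.InfiniteChainPartialMomentumReversal
import Literature.Probability.LatticeModels.GibbsSpecificationCofinal
import HarnessLib

/-!
# Under a DLR state each momentum is `N(0,T)`, independent of the position field

Topic `Literature/MathematicalPhysics/KineticTheory`; theorems only (no definitions, no named
facts), companion of `InfiniteChainGibbsMomenta.lean` (marginal law `N(0,T)` of each momentum,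
under B2) and `InfiniteChainPartialMomentumReversal.lean` (invariance of DLR states under finite
momentum reversals).

Lanford–Lebowitz–Lieb (J. Stat. Phys. **16** (1977), §4 remark (ii)): "with respect to any Gibbs
state, the `p_i` are independent, identically distributed, Gaussian random variables of mean zero"
— and independent of the positions. We prove the conditional form of this remark used by the
Green–Kubo statics of the chain, for an arbitrary nearest-neighbour chain `P : OscillatorChain`
with continuous `U`, `V`, every `T > 0` and every DLR state `μ` (`IsChainGibbsMeasure P T μ`; no
normalisability B2, temperedness or shift invariance is assumed):

* `lintegral_snd_mul_chainSpecification_singleton` — under the one-site kernel `γ_{i}(· | η)` the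
  momentum `p_i` is `N(0,T)` and independent of every observable not reading `p_i` (the Boltzmann
  weight `e^{-H_{i}/T} = e^{-p_i²/(2T)} e^{-W(q_i;η)/T}` factorises; Fubini on `dq_i dp_i`);
* `IsChainGibbsMeasure.lintegral_snd_mul` — the same under `μ` (DLR equation for observables,
  `lintegral_lintegral_eq_of_dlr` with `measurable_chainSpecification_apply`);
  `IsChainGibbsMeasure.measure_snd_preimage_inter`, `IsChainGibbsMeasure.indepFun_snd_fst` —
  **`p_i` is independent of the whole position field `(q_x)_{x ∈ ℤ}`** (Mathlib `IndepFun`), and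
  `IsChainGibbsMeasure.map_snd` — with law `N(0,T)` (`map_snd_eq_gaussianReal` without B2);
* `IsChainGibbsMeasure.integral_snd_mul_snd_mul` — equipartition given the positions,
  `∫ p_i² g(q) dμ = T ∫ g(q) dμ` for every measurable `g` of the position field (no integrability
  hypothesis: both sides are Bochner junk `0` together);
  `IsChainGibbsMeasure.integral_snd_mul_snd_mul_eq_zero` — `∫ p_i p_j g(q) dμ = 0` for `i ≠ j`
  (odd under the reversal of `p_i`);
* `IsChainGibbsMeasure.measure_eq_zero_of_siteInsert`, `IsChainGibbsMeasure.measure_fst_eq_fst` —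
  **one-site null sets**: an event all of whose one-site sections are Lebesgue-null is `μ`-null
  (`γ_{i}(· | η)` is a tilt of `dq_i dp_i ⊗ δ_η`); in particular `μ{q_i = q_j} = 0` for `i ≠ j`.

Consumer: the static current variance `C(0) = (T/4) ∫ (V'(r_0) + V'(r_1))² dμ` of a
shift-invariant DLR state (`InfiniteChainStaticCurrentVariance.lean`) and its strict positivity
for the pinned anharmonic chain. Everything is proved.
-/

noncomputable section

open MeasureTheory ProbabilityTheory Filter Set Function Literature.Probability.LatticeModels
open scoped ENNReal NNReal

namespace Literature.MathematicalPhysics.KineticTheory.HeatConduction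

/-- The position field `σ ↦ (q_x)_{x ∈ ℤ}` of the chain is measurable. [folklore] -/
theorem measurable_positionField : Measurable fun (σ : ChainConfig) (x : ℤ) => (σ x).1 :=
  measurable_pi_lambda _ fun x => (measurable_pi_apply x).fst

/-- The position field does not read the momenta: replacing `p_i` leaves `(q_x)_x` unchanged.
[folklore] -/
theorem positionField_update_snd (σ : ChainConfig) (i : ℤ) (p : ℝ) :
    (fun x : ℤ => (Function.update σ i ((σ i).1, p) x).1) = fun x => (σ x).1 := by
  funext x
  by_cases hx : x = i
  · subst hx
    simp
  · rw [Function.update_of_ne hx]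

namespace OscillatorChain

variable {P : OscillatorChain}

/-! ### The one-site kernel: `p_i` is `N(0,T)`, independent of the rest -/

/-- Replacing the datum at the inserted site re-inserts: `update (siteInsert i η z) i z' = siteInsert i η z'`.
[folklore] -/
theorem update_siteInsert (i : ℤ) (η : ChainConfig) (z z' : ℝ × ℝ) :
    Function.update (siteInsert i η z) i z' = siteInsert i η z' := by
  funext x
  by_cases hx : x = i
  · subst hx
    simp
  · rw [Function.update_of_ne hx, siteInsert_apply_of_ne hx, siteInsert_apply_of_ne hx]

/-- `∫ φ dN(0,T) = (√(2πT))⁻¹ ∫ e^{-p²/(2T)} φ(p) dp`. [folklore] -/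
theorem lintegral_gaussianReal_eq_inv_mul {T : ℝ} (hT : 0 < T) {φ : ℝ → ℝ≥0∞} (hφ : Measurable φ) :
    ∫⁻ p, φ p ∂gaussianReal 0 T.toNNReal =
      (ENNReal.ofReal (Real.sqrt (2 * Real.pi * T)))⁻¹ * ∫⁻ p, gaussWeight T p * φ p := by
  rw [gaussianReal_eq_smul_withDensity hT, lintegral_smul_measure,
    lintegral_withDensity_eq_lintegral_mul _ (measurable_gaussWeight T) hφ, smul_eq_mul]
  rfl

/-- **Under the one-site Gibbs distribution `γ_{i}(· | η)` the momentum `p_i` is `N(0,T)` and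
independent of everything else** (LLL 1977, §4 remark (ii), conditional form): for continuous
`U`, `V`, `T > 0`, every site `i`, boundary condition `η`, measurable `φ ≥ 0` on `ℝ` and
measurable `G ≥ 0` on configurations that does not read `p_i` (`G(σ[p_i ↦ p]) = G(σ)`),
`∫ φ(p_i) G dγ_{i}(· | η) = (∫ φ dN(0,T)) · ∫ G dγ_{i}(· | η)`: the Boltzmann weight
`e^{-H_{i}/T} = e^{-p_i²/(2T)} · e^{-(U(q_i) + V(q_{i+1}-q_i) + V(q_i-q_{i-1}))/T}` factorises and
Fubini applies on `dq_i dp_i`. No normalisability (B2) is needed: both sides carry the same factor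
`Z⁻¹`. [cite: LanfordLebowitzLieb1977, §4 remark (ii)] -/
theorem lintegral_snd_mul_chainSpecification_singleton (hU : Continuous P.U) (hV : Continuous P.V)
    {T : ℝ} (hT : 0 < T) (i : ℤ) (η : ChainConfig) {φ : ℝ → ℝ≥0∞} (hφ : Measurable φ)
    {G : ChainConfig → ℝ≥0∞} (hG : Measurable G)
    (hGi : ∀ (σ : ChainConfig) (p : ℝ), G (Function.update σ i ((σ i).1, p)) = G σ) :
    ∫⁻ σ, φ (σ i).2 * G σ ∂(P.chainSpecification T {i} η) =
      (∫⁻ p, φ p ∂gaussianReal 0 T.toNNReal) * ∫⁻ σ, G σ ∂(P.chainSpecification T {i} η) := by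
  -- adapted from `map_snd_chainSpecification_singleton` (InfiniteChainGibbsMomenta)
  classical
  set γ := P.chainSpecification T {i} η with hγ
  have hπ : Measurable fun σ : ChainConfig => (σ i).2 := (measurable_pi_apply i).snd
  set f : ChainConfig → ℝ := fun σ => -T⁻¹ * hamiltonianIn P.chainPotential chainSupp {i} σ
    with hf
  have hfm : Measurable f :=
    measurable_const.mul (P.continuous_hamiltonianIn_chain_singleton hU hV i).measurable
  set W : ℝ → ℝ := fun q => P.U q + (P.V ((η (i + 1)).1 - q) + P.V (q - (η (i - 1)).1)) with hW
  have hWm : Measurable W := by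
    have : Continuous W := by simp only [hW]; fun_prop
    exact this.measurable
  have hfins : ∀ z : ℝ × ℝ, Real.exp (f (siteInsert i η z)) =
      Real.exp (-T⁻¹ * W z.1) * Real.exp (-z.2 ^ 2 / (2 * T)) := by
    intro z
    have hi1 : i + 1 ≠ i := by omega
    have hi2 : i - 1 ≠ i := by omega
    rw [← Real.exp_add]
    congr 1
    simp only [hf, hamiltonianIn_chain_singleton, siteInsert_apply_self,
      siteInsert_apply_of_ne hi1, siteInsert_apply_of_ne hi2, hW]
    field_simp
    ring
  set ν₁ : Measure ChainConfig := (Measure.pi fun _ : ({i} : Finset ℤ) =>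
    (volume : Measure (ℝ × ℝ))).map (fun ζ => glueWith {i} ζ η) with hν₁
  have hν₁siteInsert : ν₁ = (volume : Measure (ℝ × ℝ)).map (siteInsert i η) :=
    map_glueWith_singleton i η
  set Z : ℝ := ∫ σ, Real.exp (f σ) ∂ν₁ with hZ
  have hγt : γ = ν₁.tilted f := rfl
  -- the observable `G` along the inserted site does not read the inserted momentum
  set g₀ : ℝ → ℝ≥0∞ := fun q => G (siteInsert i η (q, 0)) with hg₀
  have hg₀m : Measurable g₀ :=
    hG.comp ((measurable_siteInsert i η).comp (measurable_id.prodMk measurable_const))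
  have hGins : ∀ z : ℝ × ℝ, G (siteInsert i η z) = g₀ z.1 := by
    intro z
    have h := hGi (siteInsert i η (z.1, 0)) z.2
    simp only [siteInsert_apply_self, update_siteInsert, Prod.mk.eta] at h
    exact h
  -- reduction of `γ`-integrals to Lebesgue integrals over the inserted site
  have red : ∀ F : ChainConfig → ℝ≥0∞, Measurable F →
      ∫⁻ σ, F σ ∂γ = ENNReal.ofReal Z⁻¹ * ∫⁻ z : ℝ × ℝ,
        ENNReal.ofReal (Real.exp (-T⁻¹ * W z.1)) * (gaussWeight T z.2 * F (siteInsert i η z)) := by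
    intro F hF
    have hF' : Measurable fun σ : ChainConfig => ENNReal.ofReal (Real.exp (f σ)) * F σ :=
      (ENNReal.measurable_ofReal.comp (Real.measurable_exp.comp hfm)).mul hF
    calc ∫⁻ σ, F σ ∂γ
        = ∫⁻ σ, ENNReal.ofReal (Real.exp (f σ) / Z) * F σ ∂ν₁ := by rw [hγt, lintegral_tilted]
      _ = ∫⁻ σ, ENNReal.ofReal Z⁻¹ * (ENNReal.ofReal (Real.exp (f σ)) * F σ) ∂ν₁ := by
          refine lintegral_congr fun σ => ?_
          rw [div_eq_mul_inv, ENNReal.ofReal_mul (Real.exp_pos _).le]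
          ring
      _ = ENNReal.ofReal Z⁻¹ * ∫⁻ σ, ENNReal.ofReal (Real.exp (f σ)) * F σ ∂ν₁ :=
          lintegral_const_mul _ hF'
      _ = ENNReal.ofReal Z⁻¹ *
            ∫⁻ z, ENNReal.ofReal (Real.exp (f (siteInsert i η z))) * F (siteInsert i η z) := by
          rw [hν₁siteInsert, lintegral_map hF' (measurable_siteInsert i η)]
      _ = _ := by
          congr 1
          refine lintegral_congr fun z => ?_
          rw [hfins, ENNReal.ofReal_mul (Real.exp_pos _).le, gaussWeight, mul_assoc]
  -- Fubini on `dq dp`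
  have hwq : Measurable fun q : ℝ => ENNReal.ofReal (Real.exp (-T⁻¹ * W q)) * g₀ q :=
    (ENNReal.measurable_ofReal.comp (Real.measurable_exp.comp (measurable_const.mul hWm))).mul hg₀m
  set A : ℝ≥0∞ := ∫⁻ q, ENNReal.ofReal (Real.exp (-T⁻¹ * W q)) * g₀ q with hA
  set S : ℝ≥0∞ := ENNReal.ofReal (Real.sqrt (2 * Real.pi * T)) with hS
  have hS0 : S ≠ 0 := (ENNReal.ofReal_pos.2 (Real.sqrt_pos.2 (by positivity))).ne'
  have h1 : ∫⁻ σ, φ (σ i).2 * G σ ∂γ =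
      ENNReal.ofReal Z⁻¹ * (A * ∫⁻ p, gaussWeight T p * φ p) := by
    rw [red (fun σ => φ (σ i).2 * G σ) ((hφ.comp hπ).mul hG)]
    congr 1
    have e : ∀ z : ℝ × ℝ, ENNReal.ofReal (Real.exp (-T⁻¹ * W z.1)) *
        (gaussWeight T z.2 * (φ (siteInsert i η z i).2 * G (siteInsert i η z))) =
        (ENNReal.ofReal (Real.exp (-T⁻¹ * W z.1)) * g₀ z.1) * (gaussWeight T z.2 * φ z.2) := by
      intro z
      rw [siteInsert_apply_self, hGins]
      ring
    simp_rw [e]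
    rw [Measure.volume_eq_prod]
    exact lintegral_prod_mul hwq.aemeasurable ((measurable_gaussWeight T).mul hφ).aemeasurable
  have h2 : ∫⁻ σ, G σ ∂γ = ENNReal.ofReal Z⁻¹ * (A * S) := by
    rw [red _ hG]
    congr 1
    have e : ∀ z : ℝ × ℝ, ENNReal.ofReal (Real.exp (-T⁻¹ * W z.1)) *
        (gaussWeight T z.2 * G (siteInsert i η z)) =
        (ENNReal.ofReal (Real.exp (-T⁻¹ * W z.1)) * g₀ z.1) * gaussWeight T z.2 := by
      intro z
      rw [hGins]
      ring
    simp_rw [e]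
    rw [Measure.volume_eq_prod, hS, ← lintegral_gaussWeight hT]
    exact lintegral_prod_mul hwq.aemeasurable (measurable_gaussWeight T).aemeasurable
  rw [h1, h2, lintegral_gaussianReal_eq_inv_mul hT hφ]
  calc ENNReal.ofReal Z⁻¹ * (A * ∫⁻ p, gaussWeight T p * φ p)
      = ENNReal.ofReal Z⁻¹ * (A * ∫⁻ p, gaussWeight T p * φ p) * (S⁻¹ * S) := by
        rw [ENNReal.inv_mul_cancel hS0 ENNReal.ofReal_ne_top, mul_one]
    _ = S⁻¹ * (∫⁻ p, gaussWeight T p * φ p) * (ENNReal.ofReal Z⁻¹ * (A * S)) := by ring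

/-! ### DLR states: `p_i` is `N(0,T)`, independent of the position field -/

/-- **`∫ φ(p_i) G dμ = (∫ φ dN(0,T)) ∫ G dμ` for every DLR state** and every measurable `G ≥ 0` not
reading `p_i` (DLR equation for observables in the volume `{i}` on both sides, and the one-site
factorisation `lintegral_snd_mul_chainSpecification_singleton`). [cite: LanfordLebowitzLieb1977, §4 remark (ii)] -/
theorem IsChainGibbsMeasure.lintegral_snd_mul (hU : Continuous P.U) (hV : Continuous P.V)
    {T : ℝ} (hT : 0 < T) {μ : Measure ChainConfig} (hμ : P.IsChainGibbsMeasure T μ) (i : ℤ)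
    {φ : ℝ → ℝ≥0∞} (hφ : Measurable φ) {G : ChainConfig → ℝ≥0∞} (hG : Measurable G)
    (hGi : ∀ (σ : ChainConfig) (p : ℝ), G (Function.update σ i ((σ i).1, p)) = G σ) :
    ∫⁻ σ, φ (σ i).2 * G σ ∂μ = (∫⁻ p, φ p ∂gaussianReal 0 T.toNNReal) * ∫⁻ σ, G σ ∂μ := by
  have hmeas : ∀ A : Set ChainConfig, MeasurableSet A →
      Measurable fun η => P.chainSpecification T {i} η A := fun A hA =>
    P.measurable_chainSpecification_apply hU.measurable hV.measurable T {i} hA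
  have hDLR : ∀ A : Set ChainConfig, MeasurableSet A →
      ∫⁻ η, P.chainSpecification T {i} η A ∂μ = μ A := hμ.2 {i}
  have hπ : Measurable fun σ : ChainConfig => (σ i).2 := (measurable_pi_apply i).snd
  rw [← lintegral_lintegral_eq_of_dlr hmeas hDLR (f := fun σ => φ (σ i).2 * G σ)
      ((hφ.comp hπ).mul hG), ← lintegral_lintegral_eq_of_dlr hmeas hDLR hG]
  simp_rw [lintegral_snd_mul_chainSpecification_singleton hU hV hT i _ hφ hG hGi]
  rw [lintegral_const_mul]
  exact (Measure.measurable_lintegral hG).comp (Measure.measurable_of_measurable_coe _ hmeas)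

/-- **Joint law of `p_i` and the positions under a DLR state**:
`μ(p_i ∈ s, q ∈ t) = N(0,T)(s) · μ(q ∈ t)`. [cite: LanfordLebowitzLieb1977, §4 remark (ii)] -/
theorem IsChainGibbsMeasure.measure_snd_preimage_inter (hU : Continuous P.U) (hV : Continuous P.V)
    {T : ℝ} (hT : 0 < T) {μ : Measure ChainConfig} (hμ : P.IsChainGibbsMeasure T μ) (i : ℤ)
    {s : Set ℝ} (hs : MeasurableSet s) {t : Set (ℤ → ℝ)} (ht : MeasurableSet t) :
    μ ((fun σ : ChainConfig => (σ i).2) ⁻¹' s ∩ (fun (σ : ChainConfig) (x : ℤ) => (σ x).1) ⁻¹' t) =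
      gaussianReal 0 T.toNNReal s * μ ((fun (σ : ChainConfig) (x : ℤ) => (σ x).1) ⁻¹' t) := by
  have hπ : Measurable fun σ : ChainConfig => (σ i).2 := (measurable_pi_apply i).snd
  have hQ := measurable_positionField
  have hG : Measurable fun σ : ChainConfig =>
      t.indicator (1 : (ℤ → ℝ) → ℝ≥0∞) (fun x => (σ x).1) := (measurable_one.indicator ht).comp hQ
  have h := hμ.lintegral_snd_mul hU hV hT i (measurable_one.indicator hs) hG (fun σ p => by
    simp only [positionField_update_snd])
  have hR : ∫⁻ σ : ChainConfig, t.indicator (1 : (ℤ → ℝ) → ℝ≥0∞) (fun x => (σ x).1) ∂μ =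
      μ ((fun (σ : ChainConfig) (x : ℤ) => (σ x).1) ⁻¹' t) := by
    rw [← lintegral_indicator_one (ht.preimage hQ)]
    refine lintegral_congr fun σ => ?_
    by_cases h2 : (fun x : ℤ => (σ x).1) ∈ t <;> simp [h2]
  rw [lintegral_indicator_one hs, hR] at h
  rw [← h, ← lintegral_indicator_one ((hs.preimage hπ).inter (ht.preimage hQ))]
  refine lintegral_congr fun σ => ?_
  by_cases h1 : (σ i).2 ∈ s <;> by_cases h2 : (fun x : ℤ => (σ x).1) ∈ t <;> simp [h1, h2]

/-- **Each momentum of a DLR state at temperature `T > 0` has law `N(0,T)`** (no hypothesis B2;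
cf. `map_snd_eq_gaussianReal`). [cite: LanfordLebowitzLieb1977, §4 remark (ii)] -/
theorem IsChainGibbsMeasure.map_snd (hU : Continuous P.U) (hV : Continuous P.V) {T : ℝ}
    (hT : 0 < T) {μ : Measure ChainConfig} (hμ : P.IsChainGibbsMeasure T μ) (i : ℤ) :
    μ.map (fun σ : ChainConfig => (σ i).2) = gaussianReal 0 T.toNNReal := by
  haveI : IsProbabilityMeasure μ := hμ.1
  have hπ : Measurable fun σ : ChainConfig => (σ i).2 := (measurable_pi_apply i).snd
  refine Measure.ext fun s hs => ?_
  rw [Measure.map_apply hπ hs, ← Set.inter_univ ((fun σ : ChainConfig => (σ i).2) ⁻¹' s),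
    ← Set.preimage_univ (f := fun (σ : ChainConfig) (x : ℤ) => (σ x).1),
    hμ.measure_snd_preimage_inter hU hV hT i hs MeasurableSet.univ, Set.preimage_univ,
    measure_univ, mul_one]

/-- **Under every DLR state, each momentum `p_i` is independent of the position field
`(q_x)_{x ∈ ℤ}`** (Mathlib `IndepFun`; LLL 1977 §4 remark (ii)). [cite: LanfordLebowitzLieb1977, §4 remark (ii)] -/
theorem IsChainGibbsMeasure.indepFun_snd_fst (hU : Continuous P.U) (hV : Continuous P.V) {T : ℝ}
    (hT : 0 < T) {μ : Measure ChainConfig} (hμ : P.IsChainGibbsMeasure T μ) (i : ℤ) :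
    IndepFun (fun σ : ChainConfig => (σ i).2) (fun (σ : ChainConfig) (x : ℤ) => (σ x).1) μ := by
  haveI : IsProbabilityMeasure μ := hμ.1
  have hπ : Measurable fun σ : ChainConfig => (σ i).2 := (measurable_pi_apply i).snd
  rw [indepFun_iff_measure_inter_preimage_eq_mul]
  intro s t hs ht
  rw [hμ.measure_snd_preimage_inter hU hV hT i hs ht, ← Measure.map_apply hπ hs,
    hμ.map_snd hU hV hT i]

/-- `∫ p² dN(0,T) = T`. [folklore] -/
theorem integral_sq_gaussianReal {T : ℝ} (hT : 0 ≤ T) :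
    ∫ p, p ^ 2 ∂gaussianReal 0 T.toNNReal = T := by
  have h := variance_of_integral_eq_zero (μ := gaussianReal 0 T.toNNReal) (X := fun x : ℝ => x)
    measurable_id.aemeasurable integral_id_gaussianReal
  rw [variance_fun_id_gaussianReal, Real.coe_toNNReal _ hT] at h
  exact h.symm

/-- **Equipartition given the positions**: `∫ p_i² g(q) dμ = T ∫ g(q) dμ` for every DLR state at
`T > 0` and every measurable function `g` of the position field (independence and
`∫ p_i² dμ = T`; no integrability needed, both sides being Bochner junk `0` together). [cite: LanfordLebowitzLieb1977, §4 remark (ii)] -/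
theorem IsChainGibbsMeasure.integral_snd_mul_snd_mul (hU : Continuous P.U) (hV : Continuous P.V)
    {T : ℝ} (hT : 0 < T) {μ : Measure ChainConfig} (hμ : P.IsChainGibbsMeasure T μ) (i : ℤ)
    {g : (ℤ → ℝ) → ℝ} (hg : Measurable g) :
    ∫ σ, (σ i).2 * (σ i).2 * g (fun x => (σ x).1) ∂μ = T * ∫ σ, g (fun x => (σ x).1) ∂μ := by
  have hπ : Measurable fun σ : ChainConfig => (σ i).2 := (measurable_pi_apply i).snd
  have hsq : Measurable fun p : ℝ => p ^ 2 := by fun_prop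
  have h := (hμ.indepFun_snd_fst hU hV hT i).integral_fun_comp_mul_comp (f := fun p : ℝ => p ^ 2)
    (g := g) hπ.aemeasurable measurable_positionField.aemeasurable hsq.aestronglyMeasurable
    hg.aestronglyMeasurable
  have hp2 : ∫ σ, (σ i).2 ^ 2 ∂μ = T := by
    rw [← integral_map (φ := fun σ : ChainConfig => (σ i).2) hπ.aemeasurable
      hsq.aestronglyMeasurable, hμ.map_snd hU hV hT i, integral_sq_gaussianReal hT.le]
  rw [hp2] at h
  rw [← h]
  refine integral_congr_ae (Eventually.of_forall fun σ => ?_)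
  simp only
  ring

/-- **Mixed momenta are conditionally centred**: `∫ p_i p_j g(q) dμ = 0` for `i ≠ j`, every DLR
state (any `T`) and every function `g` of the positions (odd under the reversal of `p_i`, which
preserves `μ`; no integrability needed). [cite: LanfordLebowitzLieb1977, §4 remark (ii)] -/
theorem IsChainGibbsMeasure.integral_snd_mul_snd_mul_eq_zero {T : ℝ} {μ : Measure ChainConfig}
    (hμ : P.IsChainGibbsMeasure T μ) {i j : ℤ} (hij : i ≠ j) (g : (ℤ → ℝ) → ℝ) :
    ∫ σ, (σ i).2 * (σ j).2 * g (fun x => (σ x).1) ∂μ = 0 := by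
  refine integral_eq_zero_of_momentumReversalOn_odd (hμ.map_momentumReversalOn {i}) fun σ => ?_
  have hQ : (fun x => (momentumReversalOn {i} σ x).1) = fun x => (σ x).1 :=
    funext fun x => momentumReversalOn_fst _ _ _
  have hj : j ∉ ({i} : Finset ℤ) := by simpa using hij.symm
  rw [hQ, momentumReversalOn_snd_mem σ (Finset.mem_singleton_self i),
    momentumReversalOn_snd_not_mem σ hj]
  ring

/-! ### One-site null sets -/

/-- **One-site null sets of a DLR state**: if every one-site section of the measurable event `A`
is Lebesgue-null, `Leb{(q,p) : σ[i ↦ (q,p)] ∈ A} = 0` for all `σ`, then `μ(A) = 0` for every DLR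
state `μ` (any `T`): `γ_{i}(· | η)` is a tilt of `dq_i dp_i ⊗ δ_η`, hence absolutely continuous
with respect to it, and the DLR equation in the volume `{i}` integrates `γ_{i}(A | η) = 0`. [folklore] -/
theorem IsChainGibbsMeasure.measure_eq_zero_of_siteInsert {T : ℝ} {μ : Measure ChainConfig}
    (hμ : P.IsChainGibbsMeasure T μ) (i : ℤ) {A : Set ChainConfig} (hA : MeasurableSet A)
    (h0 : ∀ η : ChainConfig, volume ((siteInsert i η) ⁻¹' A) = 0) : μ A = 0 := by
  rw [← hμ.2 {i} A hA]
  have h : ∀ η : ChainConfig, P.chainSpecification T {i} η A = 0 := by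
    intro η
    have hac : P.chainSpecification T {i} η ≪ (volume : Measure (ℝ × ℝ)).map (siteInsert i η) := by
      rw [← map_glueWith_singleton i η]
      exact tilted_absolutelyContinuous _ _
    refine hac ?_
    rw [Measure.map_apply (measurable_siteInsert i η) hA]
    exact h0 η
  simp [h]

/-- **Coincidences of positions are null**: `μ{q_i = q_j} = 0` for `i ≠ j` and every DLR state
(the `i`-section of the event is the line `{q = q_j} × ℝ`). [folklore] -/
theorem IsChainGibbsMeasure.measure_fst_eq_fst {T : ℝ} {μ : Measure ChainConfig}
    (hμ : P.IsChainGibbsMeasure T μ) {i j : ℤ} (hij : i ≠ j) :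
    μ {σ | (σ i).1 = (σ j).1} = 0 := by
  have hqi : Measurable fun σ : ChainConfig => (σ i).1 := (measurable_pi_apply i).fst
  have hqj : Measurable fun σ : ChainConfig => (σ j).1 := (measurable_pi_apply j).fst
  refine hμ.measure_eq_zero_of_siteInsert i (measurableSet_eq_fun hqi hqj) fun η => ?_
  have h : (siteInsert i η) ⁻¹' {σ | (σ i).1 = (σ j).1} = {(η j).1} ×ˢ univ := by
    ext z
    simp [siteInsert_apply_of_ne hij.symm, Set.mem_prod]
  rw [h, Measure.volume_eq_prod, Measure.prod_prod, Real.volume_singleton, zero_mul]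

end OscillatorChain

end Literature.MathematicalPhysics.KineticTheory.HeatConduction

end
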